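import Literature.Claims.NS.Haitani2025
import HarnessLib

/-!
# SoloRefute — C133 `Haitani2025` (D-0090 NS-CLAIMS SWEEP; refuter ns-claims-refuter-3 g2; kit faces of
# ns-claims-typist-4 g3 adopted and credited; filed UNCHANGED by the salvage filer under conv. (b))

Row C133: K. Haitani, «Global Existence and Smoothness for 3D Navier-Stokes Equations» (GitHub
`KaworuHaitani/navier-stokes-proof-2025`, tree `375b18c7`, PDF 11 pp., PDF page = printed page; TeX line numbers `l.N` of
`navier_stokes.tex`) = bib `Haitani2025NavierStokesGitHub`; typed skeleton `Literature.Claims.NS.Haitani2025` (typist-4 g3,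
p494045 @ 552578967dbe), QUICK grain. Every public theorem below negates a typed decl of that skeleton, named under
`open Literature.Claims.NS.Haitani2025`. KILL ROUTE 3/5: explicit countermodels to printed inferences AS PRINTED, at the
grain the printed proofs consume; only one-variable real calculus and the fields of Definition 1 are used. The companion
file `SoloRefuteHaitani2025Retypes.lean` kills the three charitable re-typings of Lemma 7 (14) on the same family.

| typed decl (print locator) | theorem here | witness |
|---|---|---|
| `Step3a_Lemma7GronwallAbs` (Lemma 7 (14) p.4; proof l.248–255 «Apply Grönwall's inequality to (8)») | `not_Step3a_Lemma7GronwallAbs` | transfer family `(c,a) = (1,1)`, `k = 1`, `t = 1`: `E₁(0) = 0 < E₁(1)` (kit face, typist-4 g3) |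
| same decl — the DISPLAYED prefactor `1/log(k+1)` at `t = 0` | `not_Step3a_Lemma7GronwallAbs_timeZero` | same family, `k = 2`, `t = 0`: `1 ≤ 1/log 3` |
| `Step4_Lemma8 B` (Lemma 8 (16) p.4), EVERY `B : WaveletSystem` | `not_Step4_Lemma8` | `u = ψ_{0,j₀}`: `‖u‖²_{L²} = 1`, `‖u‖²_{W⁰_{2,log}} = 0` (`log(0+1) = 0`, Def. 2 (5) p.3) |
| `Step8a_Lemma13Abs` (Lemma 13 proof (28)–(30) p.7) | `not_Step8a_Lemma13Abs` | `N ≡ 0`, `T = C = 1`, `C₀ = 0` (kit, typist-4 g3, verbatim) |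
| `CoqL524_energyBound` (§4.2 listing l.524–530 p.9; off-path) | `not_CoqL524_energyBound` | `‖u₀‖² = C = 0`, `t = 0`, `T = 1` (kit, typist-4 g3, verbatim) |

MECHANISM (Step 3a). (8) couples level `k` to level `k+1` through `(C/log(k+1))·E_k^{1/2}E_{k+1}^{1/2}`: energy flows INTO
level `k` from level `k+1`, so `E_k(0) = 0` does not force `E_k ≡ 0`, while (14) asserts it does. Transfer family
(`haitaniG/E/M`): `G_{c,a}(t) = c a (e^{−t} − e^{−4t})/3` (solution of `G′ = −G + c a e^{−4t}`, `G(0) = 0`), `E₁ = G²`,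
`E₂ = a² e^{−8t}`, `E_k = 0` otherwise, `M = (E₁ + E₂)^{1/2}`, `ν = 1`, `C = 2c log 2`: (8) holds with EQUALITY at `k = 1, 2`
and trivially for `k ≥ 3`; (15) holds with `C₀ = (ca)² + a²` (`haitani_family_spec`). The instance `(c,a) = (1,1)` is exactly
the kit family of ns-claims-typist-4 g3 (claims/Haitani2025/typist4-kit-SoloRefuteHaitani2025.lean, sha16 33dae3b029e5ae8c),
whose proof script is reused with the two parameters threaded through.
MECHANISM (Step 4). The weight `log(k+1)` of Definition 2 (5) VANISHES at `k = 0`; a single coarsest wavelet has unit `L²`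
norm (Def. 1 item 3) and zero `W⁰_{2,log}` norm (orthogonality kills every level `k ≥ 1`); print-faithful on Def. 2 as typed.
DEPENDENCY NOTE for the VERDICT (word of record = the cell bus, not this file): in the skeleton's order Step 1 = (13) p.4 and
Step 2 = Lemma 6 (8) p.3 precede Step 3a and are basis/PDE-level (no kernel countermodel at QUICK grain); the kernel-certified
breaks are Steps 3a, 4, 8a and the Coq listing. Axioms: propext, Classical.choice, Quot.sound.

WHAT THIS IS NOT: not a claim about NS regularity or blow-up; not a claim about any author beyond the typed locator.
-/

set_option linter.dupNamespace false

noncomputable section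

namespace Summit.NavierStokesRegularity.NavierStokesRegularity.Theorems.Haitani2025

open Set MeasureTheory
open scoped InnerProductSpace
open Literature.Claims.NS.Haitani2025

/-! ## The two-parameter transfer family for Step 3a

`G_{c,a}(t) = c·a·(e^{−t} − e^{−4t})/3` solves `G′ = −G + c·a·e^{−4t}`, `G(0) = 0`; scale energies
`E₁ = G²`, `E₂ = a²e^{−8t}`, `E_k = 0` otherwise; `M = (G² + a²e^{−8t})^{1/2}`. With `ν = 1` and `C = 2c·log 2`
(so that `C/log(1+1) = 2c`) inequality (8) holds with EQUALITY at `k = 1, 2` and trivially for `k ≥ 3`, and (15)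
holds with `C₀ = (ca)² + a²`. The instance `c = a = 1` is the kit family of ns-claims-typist-4 g3 (credited); names are public so that the companion
file `SoloRefuteHaitani2025Retypes.lean` reuses them. -/

/-- `G_{c,a}(t) = c a (e^{−t} − e^{−4t})/3`. [folklore] -/
def haitaniG (c a t : ℝ) : ℝ := c * a * (Real.exp (-t) - Real.exp (-4 * t)) / 3

/-- `E₁ = G²`, `E₂ = a² e^{−8t}`, `E_k = 0` (`k ≠ 1, 2`). [folklore] -/
def haitaniE (c a : ℝ) (k : ℕ) (t : ℝ) : ℝ :=
  if k = 1 then haitaniG c a t ^ 2 else if k = 2 then a ^ 2 * Real.exp (-8 * t) else 0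

/-- `M = (E₁ + E₂)^{1/2}`. [folklore] -/
def haitaniM (c a t : ℝ) : ℝ := Real.sqrt (haitaniG c a t ^ 2 + a ^ 2 * Real.exp (-8 * t))

/-- `E₁ = G²`. [folklore] -/
theorem haitaniE_one (c a t : ℝ) : haitaniE c a 1 t = haitaniG c a t ^ 2 := by simp [haitaniE]

/-- `E₂ = a² e^{−8t}`. [folklore] -/
theorem haitaniE_two (c a t : ℝ) : haitaniE c a 2 t = a ^ 2 * Real.exp (-8 * t) := by simp [haitaniE]

/-- `E_k = 0` for `k ≠ 1, 2`. [folklore] -/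
theorem haitaniE_of_ne (c a : ℝ) {k : ℕ} (h1 : k ≠ 1) (h2 : k ≠ 2) : haitaniE c a k = fun _ => 0 := by
  funext s
  simp [haitaniE, h1, h2]

/-- `G(0) = 0`. [folklore] -/
theorem haitaniG_zero (c a : ℝ) : haitaniG c a 0 = 0 := by simp [haitaniG]

/-- `0 ≤ e^{−t} − e^{−4t} ≤ 1` for `t ≥ 0`. [folklore] -/
theorem exp_diff_mem {t : ℝ} (ht : 0 ≤ t) :
    0 ≤ Real.exp (-t) - Real.exp (-4 * t) ∧ Real.exp (-t) - Real.exp (-4 * t) ≤ 1 := by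
  have h : Real.exp (-4 * t) ≤ Real.exp (-t) := Real.exp_le_exp.mpr (by linarith)
  have h1 : Real.exp (-t) ≤ 1 := Real.exp_le_one_iff.mpr (by linarith)
  have h2 : 0 < Real.exp (-4 * t) := Real.exp_pos _
  exact ⟨sub_nonneg.mpr h, by linarith⟩

/-- `G ≥ 0` on `t ≥ 0` (for `c, a ≥ 0`). [folklore] -/
theorem haitaniG_nonneg {c a t : ℝ} (hc : 0 ≤ c) (ha : 0 ≤ a) (ht : 0 ≤ t) : 0 ≤ haitaniG c a t := by
  unfold haitaniG
  have := (exp_diff_mem ht).1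
  positivity

/-- `G ≤ c a` on `t ≥ 0` (for `c, a ≥ 0`). [folklore] -/
theorem haitaniG_le {c a t : ℝ} (hc : 0 ≤ c) (ha : 0 ≤ a) (ht : 0 ≤ t) : haitaniG c a t ≤ c * a := by
  unfold haitaniG
  have h1 := (exp_diff_mem ht).2
  have hca : 0 ≤ c * a := mul_nonneg hc ha
  have : c * a * (Real.exp (-t) - Real.exp (-4 * t)) ≤ c * a * 1 := mul_le_mul_of_nonneg_left h1 hca
  linarith

/-- `G` is continuous. [folklore] -/
theorem continuous_haitaniG (c a : ℝ) : Continuous (haitaniG c a) := by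
  show Continuous fun t : ℝ => c * a * (Real.exp (-t) - Real.exp (-4 * t)) / 3
  fun_prop

/-- `M` is continuous. [folklore] -/
theorem continuous_haitaniM (c a : ℝ) : Continuous (haitaniM c a) := by
  show Continuous fun t : ℝ => Real.sqrt (haitaniG c a t ^ 2 + a ^ 2 * Real.exp (-8 * t))
  exact (((continuous_haitaniG c a).pow 2).add (by fun_prop)).sqrt

/-- `G′ = −G + c a e^{−4t}`. [folklore] -/
theorem hasDerivAt_haitaniG (c a t : ℝ) :
    HasDerivAt (haitaniG c a) (-haitaniG c a t + c * a * Real.exp (-4 * t)) t := by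
  have h1 : HasDerivAt (fun s : ℝ => Real.exp (-s)) (Real.exp (-t) * (-1)) t := (hasDerivAt_neg t).exp
  have h2 : HasDerivAt (fun s : ℝ => Real.exp (-4 * s)) (Real.exp (-4 * t) * (-4 * 1)) t :=
    ((hasDerivAt_id' t).const_mul (-4)).exp
  have h3 : HasDerivAt (fun s : ℝ => c * a * (Real.exp (-s) - Real.exp (-4 * s)) / 3)
      (c * a * (Real.exp (-t) * (-1) - Real.exp (-4 * t) * (-4 * 1)) / 3) t :=
    ((h1.sub h2).const_mul (c * a)).div_const 3
  refine (show HasDerivAt (haitaniG c a) _ t from h3).congr_deriv ?_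
  show c * a * (Real.exp (-t) * (-1) - Real.exp (-4 * t) * (-4 * 1)) / 3 =
    -(c * a * (Real.exp (-t) - Real.exp (-4 * t)) / 3) + c * a * Real.exp (-4 * t)
  ring

/-- `E₁′ = 2GG′`. [folklore] -/
theorem hasDerivAt_haitaniE_one (c a t : ℝ) :
    HasDerivAt (haitaniE c a 1) (2 * haitaniG c a t * (-haitaniG c a t + c * a * Real.exp (-4 * t))) t := by
  have h : haitaniE c a 1 = fun s => haitaniG c a s ^ 2 := by
    funext s
    exact haitaniE_one c a s
  rw [h]
  have := (hasDerivAt_haitaniG c a t).pow 2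
  refine this.congr_deriv ?_
  push_cast
  ring

/-- `E₂′ = −8a²e^{−8t}`. [folklore] -/
theorem hasDerivAt_haitaniE_two (c a t : ℝ) :
    HasDerivAt (haitaniE c a 2) (a ^ 2 * (Real.exp (-8 * t) * (-8 * 1))) t := by
  have h : haitaniE c a 2 = fun s => a ^ 2 * Real.exp (-8 * s) := by
    funext s
    exact haitaniE_two c a s
  rw [h]
  exact (((hasDerivAt_id' t).const_mul (-8)).exp).const_mul (a ^ 2)

/-- `(a²e^{−8t})^{1/2} = a e^{−4t}` for `a ≥ 0`. [folklore] -/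
theorem sqrt_exp_neg_eight {a : ℝ} (ha : 0 ≤ a) (t : ℝ) :
    Real.sqrt (a ^ 2 * Real.exp (-8 * t)) = a * Real.exp (-4 * t) := by
  have h : a ^ 2 * Real.exp (-8 * t) = (a * Real.exp (-4 * t)) * (a * Real.exp (-4 * t)) := by
    rw [sq, mul_mul_mul_comm, ← Real.exp_add]
    ring_nf
  rw [h]
  exact Real.sqrt_mul_self (mul_nonneg ha (Real.exp_pos _).le)

/-- `log(1+1) = log 2`. [folklore] -/
theorem logW_one : logW 1 = Real.log 2 := by
  show Real.log (((1 : ℕ) : ℝ) + 1) = Real.log 2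
  norm_num

/-- `log(2+1) = log 3`. [folklore] -/
theorem logW_two : logW 2 = Real.log 3 := by
  show Real.log (((2 : ℕ) : ℝ) + 1) = Real.log 3
  norm_num

/-- The hypotheses of Step 3a hold for the family `(c, a)` with `ν = 1`, `C = 2c log 2`, `C₀ = (ca)² + a²`:
`M` continuous and nonnegative, `E_k ≥ 0` differentiable, (8) for all `k ≥ 1`, (15). [folklore] -/
theorem haitani_family_spec {c a : ℝ} (hc : 0 < c) (ha : 0 < a) :
    Continuous (haitaniM c a) ∧ (∀ t : ℝ, 0 ≤ t → 0 ≤ haitaniM c a t) ∧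
    (∀ (k : ℕ) (t : ℝ), 0 ≤ t → 0 ≤ haitaniE c a k t) ∧
    (∀ (k : ℕ) (t : ℝ), 0 ≤ t → DifferentiableWithinAt ℝ (haitaniE c a k) (Ici 0) t) ∧
    (∀ k : ℕ, 1 ≤ k → ∀ t : ℝ, 0 ≤ t →
      derivWithin (haitaniE c a k) (Ici 0) t ≤
        -2 * (1 : ℝ) * (k : ℝ) ^ 2 * haitaniE c a k t +
          2 * c * Real.log 2 / logW k * Real.sqrt (haitaniE c a k t) * Real.sqrt (haitaniE c a (k + 1) t)) ∧
    (∀ t : ℝ, 0 ≤ t → (Summable fun k => haitaniE c a k t) ∧ ∑' k, haitaniE c a k t = haitaniM c a t ^ 2 ∧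
      haitaniM c a t ^ 2 ≤ (c * a) ^ 2 + a ^ 2) := by
  have hlog : 0 < Real.log 2 := Real.log_pos (by norm_num)
  have hne : Real.log 2 ≠ 0 := hlog.ne'
  refine ⟨continuous_haitaniM c a, fun t _ => Real.sqrt_nonneg _, ?_, ?_, ?_, ?_⟩
  · intro k t _
    by_cases h1 : k = 1
    · subst h1
      rw [haitaniE_one]
      exact sq_nonneg _
    · by_cases h2 : k = 2
      · subst h2
        rw [haitaniE_two]
        positivity
      · rw [haitaniE_of_ne c a h1 h2]
  · intro k t _
    by_cases h1 : k = 1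
    · subst h1
      exact (hasDerivAt_haitaniE_one c a t).differentiableAt.differentiableWithinAt
    · by_cases h2 : k = 2
      · subst h2
        exact (hasDerivAt_haitaniE_two c a t).differentiableAt.differentiableWithinAt
      · rw [haitaniE_of_ne c a h1 h2]
        exact differentiableWithinAt_const _
  · intro k hk t ht
    have hud : UniqueDiffWithinAt ℝ (Ici (0 : ℝ)) t := uniqueDiffOn_Ici 0 t ht
    by_cases h1 : k = 1
    · subst h1
      rw [(hasDerivAt_haitaniE_one c a t).hasDerivWithinAt.derivWithin hud, logW_one]
      have hg := haitaniG_nonneg hc.le ha.le ht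
      have hs1 : Real.sqrt (haitaniE c a 1 t) = haitaniG c a t := by
        rw [haitaniE_one]
        exact Real.sqrt_sq hg
      have hs2 : Real.sqrt (haitaniE c a (1 + 1) t) = a * Real.exp (-4 * t) := by
        rw [show haitaniE c a (1 + 1) t = a ^ 2 * Real.exp (-8 * t) from haitaniE_two c a t, sqrt_exp_neg_eight ha.le]
      have hq : 2 * c * Real.log 2 / Real.log 2 = 2 * c := by
        rw [mul_div_assoc, div_self hne, mul_one]
      rw [hs1, hs2, haitaniE_one, hq]
      push_cast
      apply le_of_eq
      ring
    · by_cases h2 : k = 2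
      · subst h2
        rw [(hasDerivAt_haitaniE_two c a t).hasDerivWithinAt.derivWithin hud]
        have he3 : haitaniE c a (2 + 1) t = 0 := by simp [haitaniE]
        rw [he3, Real.sqrt_zero, mul_zero, add_zero, haitaniE_two]
        push_cast
        apply le_of_eq
        ring
      · have hz : haitaniE c a k = fun _ => (0 : ℝ) := haitaniE_of_ne c a h1 h2
        have hz' : haitaniE c a (k + 1) = fun _ => (0 : ℝ) := haitaniE_of_ne c a (by omega) (by omega)
        have hd : derivWithin (haitaniE c a k) (Ici 0) t = 0 := by
          rw [hz]
          exact (hasDerivAt_const t (0 : ℝ)).hasDerivWithinAt.derivWithin hud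
        rw [hd, hz, hz']
        simp
  · intro t ht
    have hz : ∀ k ∉ ({1, 2} : Finset ℕ), haitaniE c a k t = 0 := by
      intro k hk
      have h1 : k ≠ 1 := fun h => hk (by simp [h])
      have h2 : k ≠ 2 := fun h => hk (by simp [h])
      simp [haitaniE, h1, h2]
    have hsum : ∑' k, haitaniE c a k t = haitaniG c a t ^ 2 + a ^ 2 * Real.exp (-8 * t) := by
      rw [tsum_eq_sum hz, Finset.sum_pair (by norm_num : (1 : ℕ) ≠ 2), haitaniE_one, haitaniE_two]
    have hpos : 0 ≤ haitaniG c a t ^ 2 + a ^ 2 * Real.exp (-8 * t) := by positivity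
    have hm : haitaniM c a t ^ 2 = haitaniG c a t ^ 2 + a ^ 2 * Real.exp (-8 * t) := by
      show Real.sqrt (haitaniG c a t ^ 2 + a ^ 2 * Real.exp (-8 * t)) ^ 2 = _
      exact Real.sq_sqrt hpos
    refine ⟨summable_of_ne_finset_zero hz, by rw [hsum, hm], ?_⟩
    rw [hm]
    have he : Real.exp (-8 * t) ≤ 1 := Real.exp_le_one_iff.mpr (by linarith)
    have hg0 := haitaniG_nonneg hc.le ha.le ht
    have hg1 := haitaniG_le hc.le ha.le ht
    have hA : haitaniG c a t ^ 2 ≤ (c * a) ^ 2 := pow_le_pow_left₀ hg0 hg1 2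
    have hB : a ^ 2 * Real.exp (-8 * t) ≤ a ^ 2 := by
      have := mul_le_mul_of_nonneg_left he (sq_nonneg a)
      linarith
    linarith

/-- `M(0)² = a²` (`G(0) = 0`). [folklore] -/
theorem haitaniM_zero_sq (c : ℝ) {a : ℝ} (ha : 0 ≤ a) : haitaniM c a 0 ^ 2 = a ^ 2 := by
  show Real.sqrt (haitaniG c a 0 ^ 2 + a ^ 2 * Real.exp (-8 * 0)) ^ 2 = a ^ 2
  rw [haitaniG_zero]
  norm_num
  rw [Real.sqrt_sq ha]

/-- `E₁(0) = 0`. [folklore] -/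
theorem haitaniE_one_zero (c a : ℝ) : haitaniE c a 1 0 = 0 := by
  rw [haitaniE_one, haitaniG_zero]
  ring

/-- `E₁(t) > 0` for `t > 0`. [folklore] -/
theorem haitaniE_one_pos {c a t : ℝ} (hc : 0 < c) (ha : 0 < a) (ht : 0 < t) : 0 < haitaniE c a 1 t := by
  rw [haitaniE_one]
  have h : Real.exp (-4 * t) < Real.exp (-t) := Real.exp_lt_exp.mpr (by linarith)
  have hg : 0 < haitaniG c a t := by
    unfold haitaniG
    have := sub_pos.mpr h
    positivity
  positivity

/-! ## Step 3a — Lemma 7 (14) p.4, as printed -/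

/-- **KILL (Step 3a — the printed proof of Lemma 7, PDF p.4, TeX l.248–255: «Apply Grönwall's inequality to (8). Energy
conservation ensures (15)» does not give (14)).** Transfer family `(c,a) = (1,1)` (`ν = 1`, `C = 2 log 2`, `C₀ = 2`): every
hypothesis of the Step holds ((8) with equality at `k = 1, 2`), while (14) at `k = 1`, `t = 1` reads
`G(1)² ≤ E₁(0)/log 2 · exp(…) = 0` and `G(1) = (e^{−1} − e^{−4})/3 > 0`. Face and family of the kit of ns-claims-typist-4 g3
(credited). [cite: Haitani2025NavierStokesGitHub, Lemma 7 (14) proof p.4; Lemma 6 (8) p.3; (15) p.4] -/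
theorem not_Step3a_Lemma7GronwallAbs : ¬ Step3a_Lemma7GronwallAbs := by
  intro h
  obtain ⟨h1, h2, h3, h4, h5, h6⟩ := haitani_family_spec one_pos one_pos
  have hC : (0 : ℝ) < 2 * 1 * Real.log 2 := by
    have := Real.log_pos (by norm_num : (1 : ℝ) < 2)
    positivity
  have hmain := h 1 (2 * 1 * Real.log 2) ((1 * 1) ^ 2 + 1 ^ 2) one_pos hC (by norm_num) (haitaniE 1 1) (haitaniM 1 1)
    h1 h2 h3 h4 h5 h6 1 le_rfl 1 zero_le_one
  rw [haitaniE_one_zero, zero_div, zero_mul] at hmain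
  exact absurd hmain (not_le.mpr (haitaniE_one_pos one_pos one_pos one_pos))

/-- **KILL (Step 3a, second face — the DISPLAYED prefactor `1/log(k+1)` of (14) p.4 at `t = 0`):** (14) at `t = 0` reads
`E_k(0) ≤ E_k(0)/log(k+1)`, false for every `k ≥ 2` with `E_k(0) > 0` since `log(k+1) > 1`; on the family `(1,1)` at `k = 2`,
`t = 0` it reads `1 ≤ 1/log 3`. No inter-scale transfer is involved in this face. [cite: Haitani2025NavierStokesGitHub, Lemma 7 (14) p.4] -/
theorem not_Step3a_Lemma7GronwallAbs_timeZero : ¬ Step3a_Lemma7GronwallAbs := by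
  intro h
  obtain ⟨h1, h2, h3, h4, h5, h6⟩ := haitani_family_spec one_pos one_pos
  have hC : (0 : ℝ) < 2 * 1 * Real.log 2 := by
    have := Real.log_pos (by norm_num : (1 : ℝ) < 2)
    positivity
  have hmain := h 1 (2 * 1 * Real.log 2) ((1 * 1) ^ 2 + 1 ^ 2) one_pos hC (by norm_num) (haitaniE 1 1) (haitaniM 1 1)
    h1 h2 h3 h4 h5 h6 2 (by norm_num) 0 le_rfl
  rw [intervalIntegral.integral_same, logW_two, haitaniE_two] at hmain
  norm_num at hmain
  have hl3 : 1 < Real.log 3 := by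
    rw [Real.lt_log_iff_exp_lt (by norm_num : (0 : ℝ) < 3)]
    exact lt_trans Real.exp_one_lt_d9 (by norm_num)
  have hl : (Real.log 3)⁻¹ < 1 := inv_lt_one_of_one_lt₀ hl3
  linarith

/-! ## Step 4 — Lemma 8 (16) p.4, for every wavelet system of Definition 1 -/

/-- The coarsest index `(k, j) = (0, 0)` of the wavelet system (`Fin (2^0) = Fin 1`). [folklore] -/
def idx0 : Idx := ⟨0, fun _ => 0⟩

/-- Indices of level `k ≠ 0` differ from `(0, 0)`. [folklore] -/
theorem idx0_ne {k : ℕ} (hk : k ≠ 0) (j : Fin 3 → Fin (2 ^ k)) : idx0 ≠ ⟨k, j⟩ := by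
  intro h
  have h1 : (idx0).1 = k := congrArg Sigma.fst h
  exact hk (h1.symm.trans rfl)

/-- `log(0+1) = 0`: the weight of Definition 2 (5) vanishes at level `0`. [folklore] -/
theorem logW_zero : logW 0 = 0 := by
  show Real.log (((0 : ℕ) : ℝ) + 1) = 0
  norm_num

/-- Every level term of the `W⁰_{2,log}`-norm of a single coarsest wavelet `ψ_{0,j₀}` vanishes: at `k = 0` the
weight `log(0+1) = 0`, at `k ≥ 1` all coefficients vanish by orthogonality. [folklore] -/
theorem logW_mul_levelEnergy_psi0 (B : WaveletSystem) (k : ℕ) :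
    logW k * levelEnergy B k (B.ψ idx0) = 0 := by
  by_cases hk : k = 0
  · subst hk
    rw [logW_zero, zero_mul]
  · have hz : levelEnergy B k (B.ψ idx0) = 0 := by
      unfold levelEnergy
      refine Finset.sum_eq_zero fun j _ => ?_
      have hc : coeff B (B.ψ idx0) ⟨k, j⟩ = 0 := by
        unfold coeff
        exact B.orthogonal idx0 ⟨k, j⟩ (idx0_ne hk j)
      rw [hc]
      ring
    rw [hz, mul_zero]

/-- **KILL (Step 4 — Lemma 8 «Embedding W⁰_{2,log} ↪ H¹» (16) p.4, for EVERY wavelet system `B` of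
Definition 1):** the single coarsest wavelet `u = ψ_{0,j₀}` (the finite sum over `S = {(0,j₀)}` with coefficient
`1`) has `‖u‖²_{L²(Ω)} = 1` (Def. 1 item 3), `‖∇u‖²_{L²} ≥ 0`, but `‖u‖²_{W⁰_{2,log}} = Σ_k log(k+1)·E_k(u) = 0`
because the printed weight `log(k+1)` VANISHES at `k = 0` (Definition 2 (5) p.3) and `E_k(u) = 0` for `k ≥ 1` by
orthogonality; so (16) reads `1 + ‖∇ψ_{0,j₀}‖² ≤ C²·0`. Print-faithful on Definition 2 as typed (the `k = 0` term is
part of the norm). [cite: Haitani2025NavierStokesGitHub, Lemma 8 (16) p.4; Definition 2 (5) p.3; Definition 1 p.2] -/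
theorem not_Step4_Lemma8 (B : WaveletSystem) : ¬ Step4_Lemma8 B := by
  rintro ⟨C, _, h⟩
  have h1 := h {idx0} (fun _ => 1)
  have hfun : (fun x => ∑ a ∈ ({idx0} : Finset Idx), (fun _ : Idx => (1 : ℝ)) a • B.ψ a x) = B.ψ idx0 := by
    funext x
    simp
  rw [hfun] at h1
  have hW : wlogSq B (B.ψ idx0) = 0 := by
    unfold wlogSq
    simp_rw [logW_mul_levelEnergy_psi0 B]
    exact tsum_zero
  have hL : l2Sq (B.ψ idx0) = 1 := B.norm_one idx0
  have hG : 0 ≤ gradL2Sq (B.ψ idx0) := by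
    unfold gradL2Sq
    exact integral_nonneg fun x => Literature.Analysis.FluidPDE.frobeniusNormSq_nonneg _
  rw [hW, hL, mul_zero] at h1
  linarith

/-! ## Step 8a and the Coq listing (kit faces of ns-claims-typist-4 g3, verbatim) -/

/-- **KILL (Step 8a — the inference of Lemma 13's proof, PDF p.7, (28)–(30); Coq `self_similar_contradiction`
l.569–584): two upper bounds on `‖u(t)‖²` are not contradictory.** Witness `N ≡ 0`, `T = C = 1`, `C₀ = 0`.
[cite: Haitani2025NavierStokesGitHub, Lemma 13 proof (29)–(30) p.7] -/
theorem not_Step8a_Lemma13Abs : ¬ Step8a_Lemma13Abs := by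
  intro h
  exact h (fun _ => 0) 1 0 1 one_pos one_pos le_rfl (fun t _ => le_rfl)
    (fun t _ => by positivity) (fun t _ => le_rfl)

/-- **KILL (off-path record — §4.2 Coq listing `energy_bound`, PDF p.9, TeX l.524–530):
`(T − t)^{1/2} ≤ ‖u₀‖² + C` for all `0 ≤ t < T` is false** (`‖u₀‖² = C = 0`, `t = 0`, `T = 1`: `1 ≤ 0`).
[cite: Haitani2025NavierStokesGitHub, §4.2 listing l.524–530 p.9] -/
theorem not_CoqL524_energyBound : ¬ CoqL524_energyBound := by
  intro h
  have h1 := h 0 0 0 1 le_rfl le_rfl le_rfl one_pos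
  norm_num at h1

end Summit.NavierStokesRegularity.NavierStokesRegularity.Theorems.Haitani2025

end

-- WHAT THIS IS NOT: not a claim about NS regularity or blow-up; not a claim about any author beyond the typed
-- locator.
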